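import Mathlib.Analysis.InnerProductSpace.Projection.Basic
import Literature.Barriers.AtomisticToContinuum.MazurBoundBallistic
import Summits.AtomisticToContinuum.HydrodynamicLimit.Theses.AntiMazurCoboundaries
import HarnessLib

/-!
# The abstract anti-Mazur identity (`AntiMazurCoboundaries.AntiMazurIdentity`,
# stmt-AtomisticToContinuum-14140)

For a contraction semigroup `U` on a real Hilbert space `E` (in the weak sense of
`Literature.Barriers.AtomisticToContinuum.Mazur.IsContractionSemigroup`: no `U 0 = 1`, no use of
strong continuity) let `K = Mazur.invariantSubspace U` be the conserved vectors, `P` the orthogonal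
projection onto `K`, and `S = span {U s z - z | s ≥ 0}` the span of the coboundaries. Then for
every `A : E`

* `‖P A‖² ≤ ‖A - c‖²` for every `c ∈ S` (coboundaries are orthogonal to `K`,
  `Mazur.coboundary_mem_orthogonal`, so `P c = 0` and `‖P A‖ = ‖P (A - c)‖ ≤ ‖A - c‖`);
* the bound is sharp: for every `ε > 0` some `c ∈ S` has `‖A - c‖² < ‖P A‖² + ε`
  (`K ⊔ S` is dense, `Mazur.dense_invariant_sup_coboundaries`; approximate `B = A - P A ∈ Kᗮ` by
  `k + c`, drop `k` by Pythagoras, and `‖A - c‖² = ‖P A‖² + ‖B - c‖²` by Pythagoras again).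

This is the range side of von Neumann's mean-ergodic splitting
`E = Fix(U) ⊕ closure (span coboundaries)` read as `dist(A, span coboundaries)² = ‖P_Fix A‖²`
(Suzuki's `D(A)`), dual to Mazur's lower bound by conserved charges.

References: P. Mazur, Physica 43 (1969) 533–545; M. Suzuki, Physica 51 (1971) 277–291;
K.-J. Engel, R. Nagel, *One-Parameter Semigroups for Linear Evolution Equations* (2000) §V.4;
A. Gomilko, M. Haase, Y. Tomilov (2012) §1.
-/

namespace Summit.AtomisticToContinuum.HydrodynamicLimit.Theorems

open Literature.Barriers.AtomisticToContinuum

/-- **Upper bound.** For a contraction semigroup `U` on a real Hilbert space, every `c` in the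
span of the coboundaries `U s z - z` (`s ≥ 0`) satisfies `‖P_K A‖ ^ 2 ≤ ‖A - c‖ ^ 2`, where `P_K`
is the orthogonal projection onto the conserved vectors `K = Mazur.invariantSubspace U`:
the span of the coboundaries lies in `Kᗮ` (`Mazur.coboundary_mem_orthogonal`), so `P_K c = 0`
and `‖P_K A‖ = ‖P_K (A - c)‖ ≤ ‖A - c‖`. [folklore] -/
theorem antiMazur_norm_sq_starProjection_le {E : Type*} [NormedAddCommGroup E]
    [InnerProductSpace ℝ E] [CompleteSpace E] {U : ℝ → E →L[ℝ] E}
    (hU : Mazur.IsContractionSemigroup U) (A : E) {c : E}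
    (hc : c ∈ Submodule.span ℝ {y : E | ∃ s : ℝ, 0 ≤ s ∧ ∃ z : E, y = U s z - z}) :
    ‖(Mazur.invariantSubspace U).starProjection A‖ ^ 2 ≤ ‖A - c‖ ^ 2 := by
  set K := Mazur.invariantSubspace U with hK
  -- the coboundaries, hence their span, are orthogonal to the conserved vectors
  have hspan : Submodule.span ℝ {y : E | ∃ s : ℝ, 0 ≤ s ∧ ∃ z : E, y = U s z - z} ≤ Kᗮ := by
    refine Submodule.span_le.mpr ?_
    rintro y ⟨s, hs, z, rfl⟩
    exact Mazur.coboundary_mem_orthogonal hU hs z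
  have hPc : K.starProjection c = 0 :=
    (Submodule.starProjection_apply_eq_zero_iff (K := K)).2 (hspan hc)
  have hPA : K.starProjection A = K.starProjection (A - c) := by
    rw [map_sub, hPc, sub_zero]
  have hle : ‖K.starProjection A‖ ≤ ‖A - c‖ := by
    rw [hPA]
    exact K.norm_starProjection_apply_le (A - c)
  exact pow_le_pow_left₀ (norm_nonneg _) hle 2

/-- **Sharpness.** For a contraction semigroup `U` on a real Hilbert space, every `A` and every
`ε > 0` there is `c` in the span of the coboundaries `U s z - z` (`s ≥ 0`) with
`‖A - c‖ ^ 2 < ‖P_K A‖ ^ 2 + ε` (`K = Mazur.invariantSubspace U`): `B := A - P_K A ∈ Kᗮ` is within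
`√ε` of some `k + c` with `k ∈ K`, `c ∈ span` (`Mazur.dense_invariant_sup_coboundaries`), and two
applications of Pythagoras give `‖B - c‖ ^ 2 ≤ ‖B - (k + c)‖ ^ 2 < ε` and
`‖A - c‖ ^ 2 = ‖P_K A‖ ^ 2 + ‖B - c‖ ^ 2`. [folklore] -/
theorem antiMazur_exists_norm_sub_sq_lt {E : Type*} [NormedAddCommGroup E]
    [InnerProductSpace ℝ E] [CompleteSpace E] {U : ℝ → E →L[ℝ] E}
    (hU : Mazur.IsContractionSemigroup U) (A : E) {ε : ℝ} (hε : 0 < ε) :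
    ∃ c ∈ Submodule.span ℝ {y : E | ∃ s : ℝ, 0 ≤ s ∧ ∃ z : E, y = U s z - z},
      ‖A - c‖ ^ 2 < ‖(Mazur.invariantSubspace U).starProjection A‖ ^ 2 + ε := by
  set K := Mazur.invariantSubspace U with hK
  set S := Submodule.span ℝ {y : E | ∃ s : ℝ, 0 ≤ s ∧ ∃ z : E, y = U s z - z} with hS
  -- the span of the coboundaries is orthogonal to the conserved vectors
  have hspan : S ≤ Kᗮ := by
    refine Submodule.span_le.mpr ?_
    rintro y ⟨s, hs, z, rfl⟩
    exact Mazur.coboundary_mem_orthogonal hU hs z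
  -- `B := A - P A ∈ Kᗮ` is approximated by `K ⊔ S`, which is dense
  set B := A - K.starProjection A with hB
  have hBK : B ∈ Kᗮ := K.sub_starProjection_mem_orthogonal A
  have hdense := Mazur.dense_invariant_sup_coboundaries (E := E) hU
  obtain ⟨d, hd, hdist⟩ := hdense.exists_dist_lt B (Real.sqrt_pos.mpr hε)
  obtain ⟨k, hk, c, hc, rfl⟩ := Submodule.mem_sup.mp hd
  refine ⟨c, hc, ?_⟩
  -- first Pythagoras: dropping `k ∈ K` from `k + c` does not increase the distance to `B ∈ Kᗮ`
  have hBc : B - c ∈ Kᗮ := Kᗮ.sub_mem hBK (hspan hc)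
  have horth₁ : @inner ℝ E _ (B - c) k = 0 := by
    rw [real_inner_comm]
    exact hBc k hk
  have hpyth₁ : ‖B - (k + c)‖ * ‖B - (k + c)‖ = ‖B - c‖ * ‖B - c‖ + ‖k‖ * ‖k‖ := by
    have : B - (k + c) = (B - c) - k := by abel
    rw [this]
    exact norm_sub_sq_eq_norm_sq_add_norm_sq_real horth₁
  have hBd : ‖B - (k + c)‖ ^ 2 < ε := by
    have h := hdist
    rw [dist_eq_norm] at h
    exact (Real.lt_sqrt (norm_nonneg _)).mp h
  have hBc_lt : ‖B - c‖ ^ 2 < ε := by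
    have h1 : ‖B - c‖ ^ 2 ≤ ‖B - (k + c)‖ ^ 2 := by
      rw [sq, sq, hpyth₁]
      nlinarith [mul_self_nonneg ‖k‖]
    exact lt_of_le_of_lt h1 hBd
  -- second Pythagoras: `A - c = P A + (B - c)` with `P A ∈ K`, `B - c ∈ Kᗮ`
  have horth₂ : @inner ℝ E _ (K.starProjection A) (B - c) = 0 :=
    hBc (K.starProjection A) (K.starProjection_apply_mem A)
  have hAc : A - c = K.starProjection A + (B - c) := by
    rw [hB]
    abel
  have hpyth₂ : ‖A - c‖ ^ 2 = ‖K.starProjection A‖ ^ 2 + ‖B - c‖ ^ 2 := by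
    rw [hAc, sq, sq, sq]
    exact norm_add_sq_eq_norm_sq_add_norm_sq_real horth₂
  rw [hpyth₂]
  linarith

/-- **The abstract anti-Mazur identity** (route `AntiMazurCoboundaries`, item
stmt-AtomisticToContinuum-14140): for a contraction semigroup `U` on a real Hilbert space and any
`A`, `‖P_Inv A‖² ≤ ‖A − c‖²` for every `c` in the span of the coboundaries `U_s z − z` (`s ≥ 0`),
and the bound is attained to within any `ε > 0`; i.e. `dist(A, span coboundaries)² = ‖P_Inv A‖²`,
the coboundary (upper) side of von Neumann's mean-ergodic splitting, dual to Mazur's bound.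
Assembled from `antiMazur_norm_sq_starProjection_le` and `antiMazur_exists_norm_sub_sq_lt`.
[folklore] -/
theorem antiMazurIdentity_proof :
    Summit.AtomisticToContinuum.HydrodynamicLimit.Theses.AntiMazurCoboundaries.AntiMazurIdentity := by
  unfold Summit.AtomisticToContinuum.HydrodynamicLimit.Theses.AntiMazurCoboundaries.AntiMazurIdentity
  intro E _ _ _ U hU A
  exact ⟨fun c hc => antiMazur_norm_sq_starProjection_le hU A hc,
    fun ε hε => antiMazur_exists_norm_sub_sq_lt hU A hε⟩

end Summit.AtomisticToContinuum.HydrodynamicLimit.Theorems
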